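import Literature.NumberTheory.GaloisRepresentations.ModNCyclotomicCharacter
import HarnessLib

/-!
# The cyclotomic character modulo a prime of `\bar ℤ_K`: `D_𝔓` acts on the `ℓⁿ`-th roots of
# unity of the residue field `\bar ℤ_K/𝔓` through `χ_ℓ mod ℓⁿ`

Topic `Literature/NumberTheory/GaloisRepresentations` (vocabulary: `absIntegers (𝓞 K) K = \bar ℤ_K`,
`Ideal.decompositionSubgroup`, `GaloisRep.cyclotomicCharacter K ℓ : Γ_K →ₜ* ℤ_[ℓ]ˣ`); a
*proofs* file (theorems only), sequel of `ModNCyclotomicCharacter` (roots of unity in `\bar ℤ_K`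
and modulo `𝔓`) and `CyclotomicCharacterFrobeniusProofs` (`χ_ℓ(Frob_v) = N v`).

Serre–Tate, *Good reduction of abelian varieties* (1968), §1, uses throughout that the
decomposition group `D(v̄)` acts on the special fibre `Ã(k̄)` through its quotient
`D(v̄)/I(v̄) = Gal(k̄/k)`; when `Ã⁰` is a split torus, `Ã⁰(k̄)[ℓⁿ] = μ_{ℓⁿ}(k̄)` and this action
is the cyclotomic character *of `K`* read modulo `𝔓` (Serre, *Abelian `ℓ`-adic representations*
(1968), Ch. I §1.2: `χ_ℓ` is defined by the action on `μ_{ℓ^∞}(K̄)`, unramified at `v ∤ ℓ`,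
`χ_ℓ(F_v) = N v`).  The compatibility needed — by the torsion-point form of Serre–Tate's Lemma 2
at a split multiplicative place,
`WeierstrassCurve.serreTate_smul_torsion_of_hasSplitMultiplicativeReductionAt`
(`EllipticCurves/HasseWeilAbelianEulerFactorTorsion`) — is proved here for every `σ` in the
decomposition group, not only for Frobenius elements:

* `exists_pow_eq_one_mk_eq`: in a domain `S` with a primitive `m`-th root of unity, every
  `m`-th root of unity of `S/Q` (`Q` any prime) lifts to one of `S` (the `m` roots of `X^m - 1`
  map onto the at most `m` roots modulo `Q`, Mathlib `Polynomial.map_roots_le`,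
  `Polynomial.card_nthRoots`);
* `absIntegers.smul_eq_pow_cyclotomicCharacter_of_pow_eq_one`: `σ • μ = μ ^ (χ_ℓ(σ) mod ℓⁿ)`
  for `μ ∈ \bar ℤ_K`, `μ^{ℓⁿ} = 1` (Mathlib `cyclotomicCharacter.spec` pulled back to `\bar ℤ_K`);
* `absIntegers.mk_smul_eq_mk_pow_cyclotomicCharacter` (**main**): for a prime `𝔓` of `\bar ℤ_K`,
  `σ ∈ Γ_K` with `σ(𝔓) ⊆ 𝔓`, and `x ∈ \bar ℤ_K` with `x̄^{ℓⁿ} = 1` in `\bar ℤ_K/𝔓`: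
  **`σ x ≡ x ^ (χ_ℓ(σ) mod ℓⁿ) (mod 𝔓)`** — no hypothesis `ℓ ∉ 𝔓` is needed in this direction;
  `…_of_mem_decompositionSubgroup`: the same for `σ : 𝔓.decompositionSubgroup Γ_K`;
* `absIntegers.eq_of_pow_prime_pow_eq_one_of_mk_eq`: for `ℓ ∉ 𝔓`, reduction is injective on
  `μ_{ℓ^∞}(\bar ℤ_K)` (from `IsPrimitiveRoot.pow_eq_pow_of_sub_mem` of `ModNCyclotomicCharacter`);
  `absIntegers.natCast_notMem_of_mem_primesAbove`: `ℓ ∉ 𝔓` for `𝔓 ∣ v ∤ ℓ`.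

## References

* J.-P. Serre, J. Tate, *Good reduction of abelian varieties*, Ann. of Math. 88 (1968), §1
  (Lemma 2: the reduction isomorphism `A_m^I ≅ Ã_m` commutes with `D(v̄)`). [SerreTate1968]
* J.-P. Serre, *Abelian `ℓ`-adic representations and elliptic curves* (1968), Ch. I §1.2
  (the cyclotomic character). [SerreAbelianLadic1968]
* J.-P. Serre, *Local Fields*, GTM 67 (1979), Ch. IV §4 (roots of unity of order prime to `p`
  and the residue field).

## Design

`noncomputable section`; `K : Type u` universe-polymorphic (the consumers in `EllipticCurves`
are); theorems in `namespace Literature.NumberTheory.GaloisRepresentations` with the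
`absIntegers.` prefix for the `\bar ℤ_K`-statements, following `ModNCyclotomicCharacter`;
`(χ_ℓ(σ) mod ℓⁿ)` is written `((χ_ℓ(σ) : ℤ_[ℓ]).toZModPow n).val`, the form of Mathlib's
`cyclotomicCharacter.spec` and of the tree's `GaloisRep.cyclotomicCharacter_spec`.
-/

noncomputable section

open scoped NumberField Pointwise
open IsDedekindDomain Field Polynomial

universe u

namespace Literature.NumberTheory.GaloisRepresentations

/-! ### Roots of unity modulo a prime ideal of a domain -/

section Domain

variable {S : Type*} [CommRing S] [IsDomain S]

/-- **Every `m`-th root of unity of `S/Q` lifts to an `m`-th root of unity of `S`**, for a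
domain `S` containing a primitive `m`-th root of unity and any prime ideal `Q`: the `m` roots
of `X^m - 1` in `S` map to roots in the domain `S/Q`, which has at most `m` of them (counted
with multiplicity), so these are all of them. [folklore] -/
theorem exists_pow_eq_one_mk_eq {Q : Ideal S} [Q.IsPrime] {m : ℕ} {ζ : S}
    (hζ : IsPrimitiveRoot ζ m) (hm : 0 < m) (x : S ⧸ Q) (hx : x ^ m = 1) :
    ∃ μ : S, μ ^ m = 1 ∧ Ideal.Quotient.mk Q μ = x := by
  haveI : IsDomain (S ⧸ Q) := Ideal.Quotient.isDomain Q
  -- the roots of `X^m - 1` over `S`, mapped to `S/Q`, are all the roots there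
  have hle : (nthRoots m (1 : S)).map (Ideal.Quotient.mk Q) ≤ nthRoots m (1 : S ⧸ Q) := by
    have hmap : (X ^ m - C (1 : S)).map (Ideal.Quotient.mk Q) = X ^ m - C 1 := by
      rw [Polynomial.map_sub, Polynomial.map_pow, map_X, map_C, map_one]
    have hne : (X ^ m - C (1 : S)).map (Ideal.Quotient.mk Q) ≠ 0 := by
      rw [hmap]; exact X_pow_sub_C_ne_zero hm 1
    have := map_roots_le hne
    rwa [hmap] at this
  have hcard : Multiset.card (nthRoots m (1 : S ⧸ Q)) ≤
      Multiset.card ((nthRoots m (1 : S)).map (Ideal.Quotient.mk Q)) := by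
    rw [Multiset.card_map, hζ.card_nthRoots_one]
    exact card_nthRoots m 1
  have heq := Multiset.eq_of_le_of_card_le hle hcard
  have hxm : x ∈ nthRoots m (1 : S ⧸ Q) := (mem_nthRoots hm).mpr hx
  rw [← heq, Multiset.mem_map] at hxm
  obtain ⟨μ, hμ, rfl⟩ := hxm
  exact ⟨μ, (mem_nthRoots hm).mp hμ, rfl⟩

end Domain

/-! ### Roots of unity in `\bar ℤ_K` and the cyclotomic character -/

section NumberField

variable {K : Type u} [Field K] [NumberField K] (ℓ : ℕ) [Fact ℓ.Prime]

/-- **`Γ_K` acts on the `ℓⁿ`-th roots of unity of `\bar ℤ_K` through `χ_ℓ mod ℓⁿ`**: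
`σ • μ = μ ^ (χ_ℓ(σ) mod ℓⁿ)` for `μ ∈ \bar ℤ_K` with `μ ^ ℓⁿ = 1` (Mathlib's
`cyclotomicCharacter.spec` in `K̄`, pulled back along `\bar ℤ_K ↪ K̄`).  Serre, *Abelian `ℓ`-adic
representations* (1968), Ch. I §1.2. [folklore] -/
theorem absIntegers.smul_eq_pow_cyclotomicCharacter_of_pow_eq_one (n : ℕ)
    (σ : absoluteGaloisGroup K) {μ : absIntegers (𝓞 K) K} (hμ : μ ^ ℓ ^ n = 1) :
    σ • μ = μ ^ (((GaloisRep.cyclotomicCharacter K ℓ σ : ℤ_[ℓ]ˣ) : ℤ_[ℓ]).toZModPow n).val := by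
  haveI : NeZero (ℓ : K) := ⟨Nat.cast_ne_zero.mpr (Fact.out : ℓ.Prime).ne_zero⟩
  apply Subtype.ext
  have hμ' : ((μ : absIntegers (𝓞 K) K) : AlgebraicClosure K) ^ ℓ ^ n = 1 := by
    have := congrArg (fun z : absIntegers (𝓞 K) K ↦ (z : AlgebraicClosure K)) hμ
    simpa using this
  have h := GaloisRep.cyclotomicCharacter_spec K ℓ σ (μ : AlgebraicClosure K) hμ'
  simpa [integralClosure.coe_smul] using h

variable {ℓ}

/-- **The decomposition group acts on the `ℓⁿ`-th roots of unity of the residue field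
`\bar ℤ_K/𝔓` through `χ_ℓ mod ℓⁿ`.**  Let `𝔓` be a prime ideal of `\bar ℤ_K` and `σ ∈ Γ_K` with
`σ(𝔓) ⊆ 𝔓` (e.g. `σ ∈ D_𝔓`).  For every `x ∈ \bar ℤ_K` whose residue class is an `ℓⁿ`-th root
of unity, `σ x ≡ x ^ (χ_ℓ(σ) mod ℓⁿ) (mod 𝔓)`: the residue class lifts to a genuine `ℓⁿ`-th root
of unity `μ` of `\bar ℤ_K` (`exists_pow_eq_one_mk_eq`), on which `σ` acts by `χ_ℓ(σ) mod ℓⁿ`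
(`absIntegers.smul_eq_pow_cyclotomicCharacter_of_pow_eq_one`), and `σ` preserves congruences
modulo `𝔓`.  (No hypothesis `ℓ ∉ 𝔓` is needed for this direction.)  This is the compatibility
`μ_{ℓⁿ}(K̄) → μ_{ℓⁿ}(k̄_𝔓)` of the cyclotomic character with reduction used in Serre–Tate (1968),
§1 (action of `D(v̄)` on `Ã(k̄)` through `Gal(k̄/k)`), and Serre, *Abelian `ℓ`-adic
representations*, Ch. I §1.2 (`χ_ℓ(F_v) = N v`). [folklore] -/
theorem absIntegers.mk_smul_eq_mk_pow_cyclotomicCharacter {𝔓 : Ideal (absIntegers (𝓞 K) K)}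
    [𝔓.IsPrime] {σ : absoluteGaloisGroup K} (hσ : ∀ y ∈ 𝔓, σ • y ∈ 𝔓) (n : ℕ)
    {x : absIntegers (𝓞 K) K} (hx : Ideal.Quotient.mk 𝔓 x ^ ℓ ^ n = 1) :
    Ideal.Quotient.mk 𝔓 (σ • x) =
      Ideal.Quotient.mk 𝔓 x ^ (((GaloisRep.cyclotomicCharacter K ℓ σ : ℤ_[ℓ]ˣ) : ℤ_[ℓ]).toZModPow n).val := by
  haveI : NeZero (ℓ ^ n) := ⟨pow_ne_zero n (Fact.out : ℓ.Prime).ne_zero⟩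
  obtain ⟨ζ, hζ⟩ := exists_isPrimitiveRoot_absIntegers K (ℓ ^ n)
  obtain ⟨μ, hμ, hμx⟩ := exists_pow_eq_one_mk_eq hζ (pow_pos (Fact.out : ℓ.Prime).pos n) _ hx
  -- `x ≡ μ`, hence `σ x ≡ σ μ = μ ^ χ ≡ x ^ χ`
  have hxμ : x - μ ∈ 𝔓 := by
    rw [← Ideal.Quotient.eq, hμx]
  have hσxμ : σ • x - σ • μ ∈ 𝔓 := by
    rw [← smul_sub]
    exact hσ _ hxμ
  rw [Ideal.Quotient.eq.mpr hσxμ, absIntegers.smul_eq_pow_cyclotomicCharacter_of_pow_eq_one ℓ n σ hμ,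
    map_pow, hμx]

/-- The same for `σ` in the decomposition group `D_𝔓` (`Ideal.decompositionSubgroup`, the
stabiliser of `𝔓`). [folklore] -/
theorem absIntegers.mk_smul_eq_mk_pow_cyclotomicCharacter_of_mem_decompositionSubgroup
    {𝔓 : Ideal (absIntegers (𝓞 K) K)} [𝔓.IsPrime]
    (σ : 𝔓.decompositionSubgroup (absoluteGaloisGroup K)) (n : ℕ)
    {x : absIntegers (𝓞 K) K} (hx : Ideal.Quotient.mk 𝔓 x ^ ℓ ^ n = 1) :
    Ideal.Quotient.mk 𝔓 ((σ : absoluteGaloisGroup K) • x) =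
      Ideal.Quotient.mk 𝔓 x ^
        (((GaloisRep.cyclotomicCharacter K ℓ (σ : absoluteGaloisGroup K) : ℤ_[ℓ]ˣ) :
          ℤ_[ℓ]).toZModPow n).val := by
  obtain ⟨τ, hτ⟩ := σ
  refine absIntegers.mk_smul_eq_mk_pow_cyclotomicCharacter (fun y hy ↦ ?_) n hx
  have hτ𝔓 : τ • 𝔓 = 𝔓 := Ideal.mem_decompositionSubgroup_iff.mp hτ
  have : τ • y ∈ τ • 𝔓 := Ideal.smul_mem_pointwise_smul_iff.mpr hy
  rwa [hτ𝔓] at this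

/-- **Reduction modulo `𝔓 ∤ ℓ` is injective on the `ℓ`-power roots of unity of `\bar ℤ_K`**:
both are powers of one primitive `ℓⁿ`-th root of unity (`exists_isPrimitiveRoot_absIntegers`,
`IsPrimitiveRoot.eq_pow_of_pow_eq_one`), and distinct powers stay distinct modulo `𝔓 ∌ ℓⁿ`
(`IsPrimitiveRoot.pow_eq_pow_of_sub_mem`, `ModNCyclotomicCharacter`).  Serre, *Local Fields*,
IV §4 (the roots of unity of order prime to `p` inject into the residue field). [folklore] -/
theorem absIntegers.eq_of_pow_prime_pow_eq_one_of_mk_eq {𝔓 : Ideal (absIntegers (𝓞 K) K)}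
    [𝔓.IsPrime] (hℓ : (ℓ : absIntegers (𝓞 K) K) ∉ 𝔓) {n : ℕ} {μ₁ μ₂ : absIntegers (𝓞 K) K}
    (h₁ : μ₁ ^ ℓ ^ n = 1) (h₂ : μ₂ ^ ℓ ^ n = 1)
    (h : Ideal.Quotient.mk 𝔓 μ₁ = Ideal.Quotient.mk 𝔓 μ₂) : μ₁ = μ₂ := by
  haveI : NeZero (ℓ ^ n) := ⟨pow_ne_zero n (Fact.out : ℓ.Prime).ne_zero⟩
  obtain ⟨ζ, hζ⟩ := exists_isPrimitiveRoot_absIntegers K (ℓ ^ n)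
  obtain ⟨i, -, rfl⟩ := hζ.eq_pow_of_pow_eq_one h₁
  obtain ⟨j, -, rfl⟩ := hζ.eq_pow_of_pow_eq_one h₂
  refine hζ.pow_eq_pow_of_sub_mem (𝔓 := 𝔓) ?_ (Ideal.Quotient.eq.mp h)
  rw [Nat.cast_pow]
  exact fun hmem ↦ hℓ (Ideal.IsPrime.mem_of_pow_mem inferInstance n hmem)

omit [NumberField K] [Fact ℓ.Prime] in
/-- For a prime `𝔓` of `\bar ℤ_K` above a finite place `v ∤ ℓ`, `ℓ ∉ 𝔓`. [folklore] -/
theorem absIntegers.natCast_notMem_of_mem_primesAbove {v : HeightOneSpectrum (𝓞 K)}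
    (hv : (ℓ : 𝓞 K) ∉ v.asIdeal) {𝔓 : Ideal (absIntegers (𝓞 K) K)} (h𝔓 : 𝔓 ∈ v.primesAbove) :
    (ℓ : absIntegers (𝓞 K) K) ∉ 𝔓 := by
  intro h
  apply hv
  rw [h𝔓.2.over, Ideal.mem_under, map_natCast]
  exact h

end NumberField

end Literature.NumberTheory.GaloisRepresentations

end
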